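import Mathlib
import Summits.CriticalPhenomena.PercolationContinuityZ3.Theorems.PercNearOneGluingNoHeavyLowerTailFatMinorityTwoPorts
import Summits.CriticalPhenomena.PercolationContinuityZ3.Theorems.PercNearOneGluingNoHeavyLowerTailFatMinorityCellSlack
import Summits.CriticalPhenomena.PercolationContinuityZ3.Theorems.PercNearOneGluingNoHeavyLowerTailFatMinorityCommonPortStep
import Literature.Probability.Percolation.KozmaNitzanSmallClusters
import Literature.Probability.Percolation.KozmaNitzanGoodQuadruple
import Literature.Probability.Percolation.KozmaNitzanLemma5Slack
import HarnessLib

/-!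
# `NoHeavyLowerTail` (stmt-CriticalPhenomena-4575), line fat-minority-linear — the Case-II instance on three ports: TARGET for
# `𝒰₂ = {≥ 2 of 3 ports}` (route task `nh-dp-fatminority`, gen 11; the missing piece of THEOREM B of the notes in the tree)

Notation of `…FatMinorityInduction`.  On three ports `{v,u,q}` the only up-set without singleton member and without common port is
`𝒰₂ = {B : |B| ≥ 2}`.  `caseII_target_U2`: if `v` is the least reliable port and Case II holds at `v` (`μ₁ᵛ(c↔b) ≤ μ₁ᵛ(v↔b)`), then TARGET
holds for `𝒰₂` with every admissible `t`.  Proof (simplifying PROOF-QUT4-U2-3ports.md), `R'(y) = μ(y ↔ b off o)`: if `R'(c) ≤ R'(v)` the cells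
containing `v` but not `{u,q}` are `≤ 0` (Lemma 5, `cells_le_slack`) and the rest is the `C_u`-event `E = {e_u,e_q open}` (`commonPort_step`,
threshold `(μ(c↔b) − μ(u↔b))⁺ ≤ t`); if `R'(c) ≥ R'(v)` split along `v`: the open half is `−w(e_v)A_v − μ(σ_{v})(R'(c) − R'(v)) ≤ −w(e_v)A_v`
(on the lone cell `σ_{v}` both events are off-`o` connections, independent of the star) and the closed half is `commonPort_step` in
`μ_{w[e_v↦0]}` with threshold `≤ t + w(e_v)A_v` (`slackEdgeLemma` fed with `upsetStar_target_card_le_two`); the `A_v` terms cancel.  No definitions.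
-/

namespace Summit.CriticalPhenomena.PercolationContinuityZ3.Theorems

open MeasureTheory Set
open Literature.Probability.LatticeModels (prodBernoulli prodBernoulli_real_subset)
open Literature.Probability.Percolation

noncomputable section
open scoped Classical

variable {n : ℕ}

/-- Probability that two given distinct pairs are both open. [folklore] -/
theorem real_two_open (W : Sym2 (Fin n) → unitInterval) (e f : Sym2 (Fin n)) (hef : e ≠ f) :
    (prodBernoulli W).real ({ω | e ∈ ω} ∩ {ω | f ∈ ω}) = (W e : ℝ) * (W f : ℝ) := by
  have h := prodBernoulli_real_subset W ({e, f} : Finset (Sym2 (Fin n)))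
  have hset : {ω : Set (Sym2 (Fin n)) | (↑({e, f} : Finset (Sym2 (Fin n))) : Set (Sym2 (Fin n))) ⊆ ω} =
      {ω | e ∈ ω} ∩ {ω | f ∈ ω} := by
    ext ω
    simp only [Finset.coe_insert, Finset.coe_singleton, mem_setOf_eq, mem_inter_iff, Set.insert_subset_iff,
      Set.singleton_subset_iff]
  rw [hset] at h
  rw [h, Finset.prod_pair hef]

set_option maxHeartbeats 400000 in
/-- **TARGET for `𝒰₂ = {≥ 2 of 3 ports}` in Case II at the least reliable port.**  See the module docstring.
[cite: KozmaNitzan2024, Lemma 3 p. 6, Lemma 4 p. 9, Lemma 5 p. 13; VandenbergHaggstromKahn2005, Thm. 1.4/1.5 (p. 7); proof: route notes gen 9 (PROOF-QUT4-U2-3ports) and gen 11] -/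
theorem caseII_target_U2 (w : Sym2 (Fin n) → unitInterval) (A : Finset (Fin n)) (o v u q c b : Fin n)
    (hA : A = {v, u, q}) (hvo : v ≠ o) (huo : u ≠ o) (hqo : q ≠ o) (hvu : v ≠ u) (hvq : v ≠ q) (huq : u ≠ q)
    (hco : c ≠ o) (hbo : b ≠ o)
    (hiso : ∀ y, y ≠ o → y ∉ A → w s(o, y) = 0) (hloop : w s(o, o) = 0)
    (hmin : ∀ z ∈ A, (prodBernoulli w).real (openConn v b) ≤ (prodBernoulli w).real (openConn z b))
    (hII : (prodBernoulli (Function.update w s(o, v) 1)).real (openConn c b) ≤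
      (prodBernoulli (Function.update w s(o, v) 1)).real (openConn v b))
    (𝒰 : Finset (Finset (Fin n))) (h𝒰 : 𝒰 = A.powerset.filter (fun B => 2 ≤ B.card))
    (t : ℝ) (ht : 0 ≤ t)
    (hgap : ∀ z ∈ A, (prodBernoulli w).real (openConn c b) - (prodBernoulli w).real (openConn z b) ≤ t) :
    (prodBernoulli w).real (openConn c b ∩ {ω | ∃ B ∈ 𝒰, ∀ y ∈ B, s(o, y) ∈ ω}) -
        (prodBernoulli w).real (openConn o b ∩ {ω | ∃ B ∈ 𝒰, ∀ y ∈ B, s(o, y) ∈ ω}) ≤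
      t * (prodBernoulli w).real {ω | ∃ B ∈ 𝒰, ∀ y ∈ B, s(o, y) ∈ ω} := by
  set μ := prodBernoulli w with hμ
  set U : Set (BondConfig (Fin n)) := {ω | ∃ B ∈ 𝒰, ∀ y ∈ B, s(o, y) ∈ ω} with hU
  have hoA : o ∉ A := by
    rw [hA]; simp only [Finset.mem_insert, Finset.mem_singleton, not_or]
    exact ⟨hvo.symm, huo.symm, hqo.symm⟩
  have hvA : v ∈ A := by rw [hA]; simp
  have huA : u ∈ A := by rw [hA]; simp
  have hqA : q ∈ A := by rw [hA]; simp
  have hmemA : ∀ y, y ∈ A ↔ y = v ∨ y = u ∨ y = q := by intro y; rw [hA]; simp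
  have h𝒰A : 𝒰 ⊆ A.powerset := by rw [h𝒰]; exact Finset.filter_subset _ _
  have hmem𝒰 : ∀ B, B ∈ 𝒰 ↔ B ∈ A.powerset ∧ 2 ≤ B.card := by intro B; rw [h𝒰, Finset.mem_filter]
  have hup : ∀ B ∈ 𝒰, ∀ B' ∈ A.powerset, B ⊆ B' → B' ∈ 𝒰 := by
    intro B hB B' hB' hBB'
    exact (hmem𝒰 B').2 ⟨hB', ((hmem𝒰 B).1 hB).2.trans (Finset.card_le_card hBB')⟩
  -- the pair `{u,q}` and its event `E = {e_u, e_q open}`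
  have huq_sub : ({u, q} : Finset (Fin n)) ⊆ A := by
    intro y hy
    rcases Finset.mem_insert.1 hy with rfl | hy
    · exact huA
    · rw [Finset.mem_singleton.1 hy]; exact hqA
  have huq_mem : ({u, q} : Finset (Fin n)) ∈ 𝒰 :=
    (hmem𝒰 _).2 ⟨Finset.mem_powerset.2 huq_sub, by rw [Finset.card_pair huq]⟩
  set E : Set (BondConfig (Fin n)) := {ω | s(o, u) ∈ ω} ∩ {ω | s(o, q) ∈ ω} with hE
  have hEU : E ⊆ U := by
    intro ω hω
    refine ⟨{u, q}, huq_mem, fun y hy => ?_⟩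
    rcases Finset.mem_insert.1 hy with rfl | hy
    · exact hω.1
    · rw [Finset.mem_singleton.1 hy]; exact hω.2
  have hne_uq : s(o, u) ≠ s(o, q) := fun h => huq (Sym2.congr_right.mp h)
  have hEmono : ∀ ω ω' : BondConfig (Fin n), ω ∈ E → openEdgeCluster ω u ⊆ openEdgeCluster ω' u → ω' ∈ E := by
    intro ω ω' hω hsub
    have hadj : (openGraph ω).Adj u o := (openGraph_adj ω u o).2 ⟨by rw [Sym2.eq_swap]; exact hω.1, huo⟩
    have hreach : (openGraph ω).Reachable u o := hadj.reachable
    exact ⟨openEdgeCluster_subset ω' u (hsub (mk_mem_openEdgeCluster huo hω.1 hreach)),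
      openEdgeCluster_subset ω' u (hsub (mk_mem_openEdgeCluster hqo hω.2 hreach))⟩
  have hob_E : (openConn o b : Set (BondConfig (Fin n))) ∩ E = openConn u b ∩ E := by
    have h := openConn_inter_edgeOpen_eq huo b ({ω : BondConfig (Fin n) | s(o, q) ∈ ω})
    simpa only [hE] using h
  have hEval : ∀ W : Sym2 (Fin n) → unitInterval, W s(o, u) = w s(o, u) → W s(o, q) = w s(o, q) →
      (prodBernoulli W).real E = μ.real E := by
    intro W hWu hWq
    rw [hE, real_two_open W _ _ hne_uq, real_two_open w _ _ hne_uq, hWu, hWq]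
  have hEle : μ.real E ≤ μ.real U := measureReal_mono hEU
  have hE1 : μ.real E ≤ 1 := by
    have := measureReal_mono (μ := μ) (Set.subset_univ E)
    rwa [probReal_univ] at this
  set Rc : ℝ := μ.real (openConnIn ({o}ᶜ : Set (Fin n)) c b) with hRc
  set Rv : ℝ := μ.real (openConnIn ({o}ᶜ : Set (Fin n)) v b) with hRv
  by_cases hcase : Rc ≤ Rv
  · /- EASY CASE `R'(c) ≤ R'(v)` -/
    set 𝒲 : Finset (Finset (Fin n)) := A.powerset.filter (fun B => ({u, q} : Finset (Fin n)) ⊆ B) with h𝒲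
    have hmem𝒲 : ∀ B, B ∈ 𝒲 ↔ B ∈ A.powerset ∧ ({u, q} : Finset (Fin n)) ⊆ B := by
      intro B; rw [h𝒲, Finset.mem_filter]
    have h𝒲A : 𝒲 ⊆ A.powerset := by rw [h𝒲]; exact Finset.filter_subset _ _
    have h𝒲up : ∀ B ∈ 𝒲, ∀ B' ∈ A.powerset, B ⊆ B' → B' ∈ 𝒲 := by
      intro B hB B' hB' hBB'
      exact (hmem𝒲 _).2 ⟨hB', ((hmem𝒲 _).1 hB).2.trans hBB'⟩
    have hWevent : {ω : BondConfig (Fin n) | ∃ B ∈ 𝒲, ∀ y ∈ B, s(o, y) ∈ ω} = E := by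
      ext ω
      simp only [mem_setOf_eq, hE, mem_inter_iff]
      constructor
      · rintro ⟨B, hB, hop⟩
        have hsub := ((hmem𝒲 B).1 hB).2
        exact ⟨hop u (hsub (by simp)), hop q (hsub (by simp))⟩
      · rintro ⟨hu, hq⟩
        refine ⟨{u, q}, (hmem𝒲 _).2 ⟨Finset.mem_powerset.2 huq_sub, subset_rfl⟩, fun y hy => ?_⟩
        rcases Finset.mem_insert.1 hy with rfl | hy
        · exact hu
        · rw [Finset.mem_singleton.1 hy]; exact hq
    -- split `𝒰` by the predicate `{u,q} ⊆ B`
    have hfilter_eq : 𝒰.filter (fun B => ({u, q} : Finset (Fin n)) ⊆ B) = 𝒲 := by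
      ext B
      rw [Finset.mem_filter, hmem𝒰, hmem𝒲]
      constructor
      · rintro ⟨⟨hBA, -⟩, hsub⟩; exact ⟨hBA, hsub⟩
      · rintro ⟨hBA, hsub⟩
        refine ⟨⟨hBA, ?_⟩, hsub⟩
        calc 2 = ({u, q} : Finset (Fin n)).card := (Finset.card_pair huq).symm
          _ ≤ B.card := Finset.card_le_card hsub
    have hv_of_not : ∀ B ∈ 𝒰.filter (fun B => ¬ ({u, q} : Finset (Fin n)) ⊆ B), v ∈ B := by
      intro B hB
      obtain ⟨hB𝒰, hnot⟩ := Finset.mem_filter.1 hB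
      obtain ⟨hBA, hcard⟩ := (hmem𝒰 B).1 hB𝒰
      by_contra hvB
      apply hnot
      -- `B ⊆ {u,q}` with `|B| ≥ 2` forces `B = {u,q}`
      have hBsub : B ⊆ ({u, q} : Finset (Fin n)) := by
        intro y hy
        rcases (hmemA y).1 (Finset.mem_powerset.1 hBA hy) with rfl | rfl | rfl
        · exact (hvB hy).elim
        · simp
        · simp
      have hBeq : B = {u, q} :=
        Finset.eq_of_subset_of_card_le hBsub (by rw [Finset.card_pair huq]; exact hcard)
      rw [hBeq]
    have hsum : ∀ X : Set (BondConfig (Fin n)), μ.real (X ∩ U) =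
        ∑ B ∈ 𝒰.filter (fun B => ¬ ({u, q} : Finset (Fin n)) ⊆ B), μ.real (X ∩ starEvent o (↑B : Set (Fin n))) +
          μ.real (X ∩ E) := by
      intro X
      rw [real_inter_starUpEvent_eq_sum w A o hoA hiso 𝒰 h𝒰A hup X, ← hWevent,
        real_inter_starUpEvent_eq_sum w A o hoA hiso 𝒲 h𝒲A h𝒲up X, ← hfilter_eq,
        ← Finset.sum_filter_add_sum_filter_not 𝒰 (fun B => ({u, q} : Finset (Fin n)) ⊆ B), add_comm]
    -- cells containing `v` (and not `{u,q}`): Lemma 5 with zero slack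
    have hcells := cells_le_slack w o c b hco (𝒰.filter (fun B => ¬ ({u, q} : Finset (Fin n)) ⊆ B)) (fun _ => v)
      (fun B hB => hv_of_not B hB) (fun _ _ => hvo)
    have hzero : ∀ B ∈ 𝒰.filter (fun B => ¬ ({u, q} : Finset (Fin n)) ⊆ B),
        max 0 (μ.real (openConnIn ({o}ᶜ : Set (Fin n)) c b) - μ.real (openConnIn ({o}ᶜ : Set (Fin n)) v b)) *
          μ.real (starEvent o (↑B : Set (Fin n))) = 0 := by
      intro B _
      have : max 0 (Rc - Rv) = 0 := max_eq_left (by linarith)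
      rw [this, zero_mul]
    rw [Finset.sum_congr rfl hzero, Finset.sum_const_zero] at hcells
    -- assemble
    have hcb := hsum (openConn c b)
    have hob := hsum (openConn o b)
    rw [hob_E] at hob
    have hcommonE : μ.real (openConn c b ∩ E) - μ.real (openConn u b ∩ E) ≤ t * μ.real E := by
      have h := commonPort_step w c u b E hEmono
      have hmax : max 0 (μ.real (openConn c b) - μ.real (openConn u b)) ≤ t := max_le ht (hgap u huA)
      have hE0 : 0 ≤ μ.real E := measureReal_nonneg
      nlinarith [h, hmax, hE0]
    rw [hcb, hob]
    rw [Finset.sum_sub_distrib] at hcells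
    have h2 : t * μ.real E ≤ t * μ.real U := mul_le_mul_of_nonneg_left hEle ht
    linarith [hcells, hcommonE, h2]
  · /- HARD CASE `R'(c) > R'(v)`: split along `v` -/
    have hcase' : Rv ≤ Rc := le_of_lt (not_le.1 hcase)
    set e : Sym2 (Fin n) := s(o, v) with he
    set μ₁ := prodBernoulli (Function.update w e 1) with hμ₁
    set μ₀ := prodBernoulli (Function.update w e 0) with hμ₀
    set p : ℝ := (w e : ℝ) with hp
    have hp0 : 0 ≤ p := (w e).2.1
    have hp1 : p ≤ 1 := (w e).2.2
    set Av : ℝ := μ₁.real (openConn v b) - μ₁.real (openConn c b) with hAv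
    have hAv0 : 0 ≤ Av := by simp only [hAv]; linarith [hII]
    have hsc := real_inter_upEvent_split μ e (openConn c b) U
    have hso := real_inter_upEvent_split μ e (openConn o b) U
    have hsU : μ.real U = μ.real ({ω | e ∈ ω} ∩ U) + μ.real (U ∩ {ω | e ∉ ω}) := by
      have h := real_inter_upEvent_split μ e Set.univ U
      simpa only [Set.univ_inter] using h
    have hUclosed : U ∩ {ω | e ∉ ω} = E ∩ {ω | e ∉ ω} := by
      ext ω
      constructor
      · rintro ⟨⟨B, hB, hop⟩, hev⟩
        refine ⟨?_, hev⟩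
        obtain ⟨hBA, hcard⟩ := (hmem𝒰 B).1 hB
        have hvB : v ∉ B := fun h => hev (hop v h)
        have hBsub : B ⊆ ({u, q} : Finset (Fin n)) := by
          intro y hy
          rcases (hmemA y).1 (Finset.mem_powerset.1 hBA hy) with rfl | rfl | rfl
          · exact (hvB hy).elim
          · simp
          · simp
        have hBeq : B = {u, q} :=
          Finset.eq_of_subset_of_card_le hBsub (by rw [Finset.card_pair huq]; exact hcard)
        subst hBeq
        exact ⟨hop u (by simp), hop q (by simp)⟩
      · rintro ⟨hEω, hev⟩
        exact ⟨hEU hEω, hev⟩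
    have hcl : ∀ X : Set (BondConfig (Fin n)), μ.real (X ∩ U ∩ {ω | e ∉ ω}) = (1 - p) * μ₀.real (X ∩ E) := by
      intro X
      rw [Set.inter_assoc, hUclosed, ← Set.inter_assoc,
        real_of_subset_edgeClosed w e _ (fun ω hω => hω.2), ← real_update_zero_eq_inter_edgeClosed]
    have hclU : μ.real (U ∩ {ω | e ∉ ω}) = (1 - p) * μ₀.real E := by
      rw [hUclosed, real_of_subset_edgeClosed w e _ (fun ω hω => hω.2), ← real_update_zero_eq_inter_edgeClosed]
    have hμ₀E : μ₀.real E = μ.real E := by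
      apply hEval
      · exact Function.update_of_ne (fun h => hvu.symm (Sym2.congr_right.mp h)) _ _
      · exact Function.update_of_ne (fun h => hvq.symm (Sym2.congr_right.mp h)) _ _
    -- (3) the closed half bounded by the common-port step in `μ₀` with threshold `t + p·Av`
    have hbond : ∀ y : Fin n, μ.real (openConn y b) = (1 - p) * μ₀.real (openConn y b) + p * μ₁.real (openConn y b) :=
      fun y => prodBernoulli_real_oneBond (determinedBy_univ_fin _) w (Finset.mem_univ e)
    have hIH2 := fun (t' : ℝ) (ht' : 0 ≤ t')
        (hdom : ∀ y ∈ A.erase v, μ₀.real (openConn v b) - μ₀.real (openConn y b) ≤ t')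
        (𝒰' : Finset (Finset (Fin n))) (h𝒰' : 𝒰' ⊆ (A.erase v).powerset) (h0' : ∅ ∉ 𝒰')
        (hup' : ∀ B ∈ 𝒰', ∀ B' ∈ (A.erase v).powerset, B ⊆ B' → B' ∈ 𝒰') => by
      have hcard : (A.erase v).card ≤ 2 := by
        rw [Finset.card_erase_of_mem hvA, hA, Finset.card_insert_of_notMem (by simp [hvu, hvq]),
          Finset.card_pair huq]
      have hoA' : o ∉ A.erase v := fun h => hoA (Finset.mem_of_mem_erase h)
      have hiso' : ∀ y, y ≠ o → y ∉ A.erase v → Function.update w e 0 s(o, y) = 0 := by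
        intro y hyo hy
        by_cases hyv : y = v
        · subst hyv; simp only [he, Function.update_self]
        · have hne : s(o, y) ≠ e := fun h => hyv (Sym2.congr_right.mp h)
          simp only [Function.update_of_ne hne]
          exact hiso y hyo (fun hyA => hy (Finset.mem_erase.2 ⟨hyv, hyA⟩))
      have hloop' : Function.update w e 0 s(o, o) = 0 := by
        have hne : s(o, o) ≠ e := fun h => hvo (Sym2.congr_right.mp h).symm
        simp only [Function.update_of_ne hne]; exact hloop
      exact upsetStar_target_card_le_two (Function.update w e 0) (A.erase v) o b v hcard hoA' hiso' hloop'
        𝒰' h𝒰' h0' hup' hvo t' ht' hdom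
    have hedge := slackEdgeLemma w A o v b u hoA hvA huo hiso hloop (μ.real (openConn v b)) hmin hIH2
    -- hedge : (1 − p)((μ₁ ub − μ₀ ub) − (μ₁ vb − μ₀ vb)) ≤ μ vb − μ vb = 0
    have hthr : (1 - p) * max 0 (μ₀.real (openConn c b) - μ₀.real (openConn u b)) ≤ t + p * Av := by
      have h1 := hbond c
      have h2 := hbond u
      have h3 := hbond v
      have h4 := hgap u huA
      have h5 := hgap v hvA
      have h1p : 0 ≤ 1 - p := by linarith
      rcases le_or_gt (μ₀.real (openConn c b) - μ₀.real (openConn u b)) 0 with hneg | hpos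
      · rw [max_eq_left hneg, mul_zero]; nlinarith [hp0, hAv0]
      · rw [max_eq_right hpos.le]
        simp only [hAv]
        nlinarith [h1, h2, h3, h4, h5, hedge, hp0, h1p]
    have hF0 : μ.real (openConn c b ∩ U ∩ {ω | e ∉ ω}) - μ.real (openConn o b ∩ U ∩ {ω | e ∉ ω}) ≤
        (t + p * Av) * μ.real E := by
      rw [hcl, hcl, hob_E]
      have h := commonPort_step (Function.update w e 0) c u b E hEmono
      have hE0 : 0 ≤ μ₀.real E := measureReal_nonneg
      have h1p : 0 ≤ 1 - p := by linarith
      have := mul_le_mul_of_nonneg_left h h1p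
      rw [← hμ₀E]
      nlinarith [this, hthr, hE0, mul_le_mul_of_nonneg_right hthr hE0]
    -- (4) the open half: `μ(X ∩ ({e}∩U)) = μ(X ∩ {e}) − μ(X ∩ σ_{v})`
    set 𝒰v : Finset (Finset (Fin n)) := A.powerset.filter (fun B => v ∈ B) with h𝒰v
    set 𝒰v2 : Finset (Finset (Fin n)) := 𝒰.filter (fun B => v ∈ B) with h𝒰v2
    have hmem𝒰v : ∀ B, B ∈ 𝒰v ↔ B ∈ A.powerset ∧ v ∈ B := by intro B; rw [h𝒰v, Finset.mem_filter]
    have hmem𝒰v2 : ∀ B, B ∈ 𝒰v2 ↔ B ∈ 𝒰 ∧ v ∈ B := by intro B; rw [h𝒰v2, Finset.mem_filter]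
    have h𝒰vA : 𝒰v ⊆ A.powerset := by rw [h𝒰v]; exact Finset.filter_subset _ _
    have h𝒰v2A : 𝒰v2 ⊆ A.powerset := by rw [h𝒰v2]; exact (Finset.filter_subset _ _).trans h𝒰A
    have h𝒰vup : ∀ B ∈ 𝒰v, ∀ B' ∈ A.powerset, B ⊆ B' → B' ∈ 𝒰v := fun B hB B' hB' hBB' => by
      rw [h𝒰v, Finset.mem_filter] at hB ⊢; exact ⟨hB', hBB' hB.2⟩
    have h𝒰v2up : ∀ B ∈ 𝒰v2, ∀ B' ∈ A.powerset, B ⊆ B' → B' ∈ 𝒰v2 := fun B hB B' hB' hBB' => by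
      rw [h𝒰v2, Finset.mem_filter] at hB ⊢; exact ⟨hup B hB.1 B' hB' hBB', hBB' hB.2⟩
    have hev1 : {ω : BondConfig (Fin n) | ∃ B ∈ 𝒰v, ∀ y ∈ B, s(o, y) ∈ ω} = {ω | e ∈ ω} := by
      ext ω
      simp only [mem_setOf_eq]
      constructor
      · rintro ⟨B, hB, hop⟩; exact hop v ((hmem𝒰v B).1 hB).2
      · intro hω
        exact ⟨{v}, (hmem𝒰v _).2 ⟨Finset.mem_powerset.2 (Finset.singleton_subset_iff.2 hvA),
          Finset.mem_singleton_self v⟩, fun y hy => by rw [Finset.mem_singleton.1 hy]; exact hω⟩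
    have hev2 : {ω : BondConfig (Fin n) | ∃ B ∈ 𝒰v2, ∀ y ∈ B, s(o, y) ∈ ω} = {ω | e ∈ ω} ∩ U := by
      ext ω
      simp only [mem_setOf_eq, mem_inter_iff, hU]
      constructor
      · rintro ⟨B, hB, hop⟩
        exact ⟨hop v ((hmem𝒰v2 B).1 hB).2, B, ((hmem𝒰v2 B).1 hB).1, hop⟩
      · rintro ⟨hω, B, hB, hop⟩
        refine ⟨insert v B, (hmem𝒰v2 _).2 ⟨hup B hB _ ?_ (Finset.subset_insert v B), Finset.mem_insert_self v B⟩, ?_⟩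
        · exact Finset.mem_powerset.2 (Finset.insert_subset hvA (Finset.mem_powerset.1 (h𝒰A hB)))
        · intro y hy
          rcases Finset.mem_insert.1 hy with rfl | hy
          · exact hω
          · exact hop y hy
    have hsingle : ({v} : Finset (Fin n)) ∉ 𝒰v2 := by
      intro h
      have := ((hmem𝒰 _).1 ((hmem𝒰v2 _).1 h).1).2
      rw [Finset.card_singleton] at this
      omega
    have h𝒰v_eq : 𝒰v = insert ({v} : Finset (Fin n)) 𝒰v2 := by
      ext B
      simp only [h𝒰v, h𝒰v2, Finset.mem_insert, Finset.mem_filter, hmem𝒰]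
      constructor
      · rintro ⟨hBA, hvB⟩
        by_cases hcard : 2 ≤ B.card
        · exact Or.inr ⟨⟨hBA, hcard⟩, hvB⟩
        · left
          push Not at hcard
          have hle : B.card ≤ 1 := by omega
          exact Finset.eq_singleton_iff_unique_mem.2 ⟨hvB, fun y hy => Finset.card_le_one.1 hle y hy v hvB⟩
      · rintro (rfl | ⟨⟨hBA, -⟩, hvB⟩)
        · exact ⟨Finset.mem_powerset.2 (Finset.singleton_subset_iff.2 hvA), Finset.mem_singleton_self v⟩
        · exact ⟨hBA, hvB⟩
    have hopen : ∀ X : Set (BondConfig (Fin n)), μ.real (X ∩ ({ω | e ∈ ω} ∩ U)) =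
        μ.real (X ∩ {ω | e ∈ ω}) - μ.real (X ∩ starEvent o (↑({v} : Finset (Fin n)) : Set (Fin n))) := by
      intro X
      rw [← hev2, ← hev1, real_inter_starUpEvent_eq_sum w A o hoA hiso 𝒰v2 h𝒰v2A h𝒰v2up X,
        real_inter_starUpEvent_eq_sum w A o hoA hiso 𝒰v h𝒰vA h𝒰vup X, h𝒰v_eq, Finset.sum_insert hsingle]
      ring
    -- (5) `μ(X ∩ {e open})` transfers to `μ₁`
    have hop_c : μ.real (openConn c b ∩ {ω | e ∈ ω}) = p * μ₁.real (openConn c b) := by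
      rw [real_of_subset_edgeOpen w e _ (fun ω hω => hω.2), ← real_update_one_eq_inter_edgeOpen]
    have hop_o : μ.real (openConn o b ∩ {ω | e ∈ ω}) = p * μ₁.real (openConn v b) := by
      have hset : (openConn o b : Set (BondConfig (Fin n))) ∩ {ω | e ∈ ω} = openConn v b ∩ {ω | e ∈ ω} := by
        have h := openConn_inter_edgeOpen_eq hvo b (Set.univ : Set (BondConfig (Fin n)))
        simpa only [Set.inter_univ] using h
      rw [hset, real_of_subset_edgeOpen w e _ (fun ω hω => hω.2), ← real_update_one_eq_inter_edgeOpen]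
    -- (6) the lone cell `σ_{v}`: both events are off-`o` connections, independent of the star
    have hσc : (openConn c b : Set (BondConfig (Fin n))) ∩ starEvent o (↑({v} : Finset (Fin n)) : Set (Fin n)) =
        starEvent o (↑({v} : Finset (Fin n)) : Set (Fin n)) ∩ openConnIn ({o}ᶜ : Set (Fin n)) c b := by
      ext ω
      simp only [mem_inter_iff, Finset.coe_singleton]
      constructor
      · rintro ⟨hcb, hσ⟩
        refine ⟨hσ, ?_⟩
        rcases (KNPreFKG.reachable_iff_of_mem_starEvent hσ hco hbo).1 hcb with h | ⟨⟨u', hu', -, hcu'⟩, ⟨u'', hu'', -, hu''b⟩⟩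
        · exact h
        · rw [Set.mem_singleton_iff.1 hu'] at hcu'
          rw [Set.mem_singleton_iff.1 hu''] at hu''b
          exact KNPreFKG.openConnIn_trans hcu' hu''b
      · rintro ⟨hσ, h⟩
        exact ⟨(KNPreFKG.reachable_iff_of_mem_starEvent hσ hco hbo).2 (Or.inl h), hσ⟩
    have hσo : (openConn o b : Set (BondConfig (Fin n))) ∩ starEvent o (↑({v} : Finset (Fin n)) : Set (Fin n)) =
        starEvent o (↑({v} : Finset (Fin n)) : Set (Fin n)) ∩ openConnIn ({o}ᶜ : Set (Fin n)) v b := by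
      ext ω
      simp only [mem_inter_iff, Finset.coe_singleton]
      constructor
      · rintro ⟨hob', hσ⟩
        refine ⟨hσ, ?_⟩
        obtain ⟨u', hu', -, h⟩ := (KNPreFKG.reachable_center_iff_of_mem_starEvent hσ hbo).1 hob'
        rw [Set.mem_singleton_iff.1 hu'] at h
        exact h
      · rintro ⟨hσ, h⟩
        exact ⟨(KNPreFKG.reachable_center_iff_of_mem_starEvent hσ hbo).2 ⟨v, Set.mem_singleton v, hvo, h⟩, hσ⟩
    have hind_c : μ.real (openConn c b ∩ starEvent o (↑({v} : Finset (Fin n)) : Set (Fin n))) =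
        μ.real (starEvent o (↑({v} : Finset (Fin n)) : Set (Fin n))) * Rc := by
      rw [hσc]
      exact KNGoodAux.real_starEvent_inter_of_determinedBy w o _ (KNPreFKG.determinedBy_openConnIn _ c b)
    have hind_o : μ.real (openConn o b ∩ starEvent o (↑({v} : Finset (Fin n)) : Set (Fin n))) =
        μ.real (starEvent o (↑({v} : Finset (Fin n)) : Set (Fin n))) * Rv := by
      rw [hσo]
      exact KNGoodAux.real_starEvent_inter_of_determinedBy w o _ (KNPreFKG.determinedBy_openConnIn _ v b)
    have hσ0 : 0 ≤ μ.real (starEvent o (↑({v} : Finset (Fin n)) : Set (Fin n))) := measureReal_nonneg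
    have hF1 : μ.real (openConn c b ∩ ({ω | e ∈ ω} ∩ U)) - μ.real (openConn o b ∩ ({ω | e ∈ ω} ∩ U)) ≤ -(p * Av) := by
      rw [hopen, hopen, hop_c, hop_o, hind_c, hind_o]
      have hnn : 0 ≤ μ.real (starEvent o (↑({v} : Finset (Fin n)) : Set (Fin n))) * (Rc - Rv) :=
        mul_nonneg hσ0 (by linarith)
      have hexp : μ.real (starEvent o (↑({v} : Finset (Fin n)) : Set (Fin n))) * (Rc - Rv) =
          μ.real (starEvent o (↑({v} : Finset (Fin n)) : Set (Fin n))) * Rc -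
            μ.real (starEvent o (↑({v} : Finset (Fin n)) : Set (Fin n))) * Rv := by ring
      have hAv' : p * Av = p * μ₁.real (openConn v b) - p * μ₁.real (openConn c b) := by simp only [hAv]; ring
      linarith
    have h1 : p * Av * μ.real E ≤ p * Av := mul_le_of_le_one_right (mul_nonneg hp0 hAv0) hE1
    have h2 : t * μ.real E ≤ t * μ.real U := mul_le_mul_of_nonneg_left hEle ht
    have hF0' : μ.real (openConn c b ∩ U ∩ {ω | e ∉ ω}) - μ.real (openConn o b ∩ U ∩ {ω | e ∉ ω}) ≤
        t * μ.real E + p * Av * μ.real E := by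
      have : (t + p * Av) * μ.real E = t * μ.real E + p * Av * μ.real E := by ring
      linarith [hF0]
    rw [hsc, hso]
    linarith [hF1, hF0', h1, h2]

end

end Summit.CriticalPhenomena.PercolationContinuityZ3.Theorems
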